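import Literature.NumberTheory.Transcendental.NesterenkoElimination
import Literature.RingTheory.KrullDimension.AffineCatenary
import Mathlib.RingTheory.Ideal.AssociatedPrime.Basic
import Mathlib.RingTheory.Polynomial.UniqueFactorization
import HarnessLib

/-!
# Philippon's criterion over Nesterenko's toolkit, X: principal ideals of `ℚ[x₀, …, x_m]` are unmixed of rank `m` — proofs only

`Literature/NumberTheory/Transcendental/PhilipponCriterionPrincipal.lean` — proofs only (no new
definitions, nothing asserted). LNM 1752 Ch. 3 Prop. 4.8 (the tree's named fact
`NesterenkoPhilippon2001_ch3_prop_4_8`, `NesterenkoEliminationFacts2.lean`) is printed for "a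
principal ideal `I = (P)`" to which Nesterenko's Definitions 4.5–4.6 apply, i.e. `(P)` homogeneous
unmixed with `dim (P) = m − 1`; the vendored fact carries `IsUnmixedOfRank (Ideal.span {P}) m` as an
explicit hypothesis. This file PROVES it for every non-zero non-unit `P` (Macaulay's unmixedness of
principal ideals in the factorial ring `ℚ[x₀, …, x_m]`): an associated prime of `(P)` is
`((P) : x) = (P / gcd(P, x))` (colon ideals of principal ideals in a GCD domain are principal), a
prime principal ideal `(p)`, and `dim ℚ[x̲] ⧸ (p) = m` for a prime `p` of `ℚ[x₀, …, x_m]`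
(`Literature.RingTheory.KrullDimension.ringKrullDim_quotient_span_of_prime_mvPolynomial`, Matsumura
Thm 5.6). It is used for the first cut of Philippon's induction when the starting prime is `(0)`
(`θ` generic, `k = n`: the case of Gel'fond's criterion in dimension `n`).

## References

* [NesterenkoPhilippon2001] LNM 1752 (2001), Ch. 3 Prop. 4.8 (p. 40) and footnote 5 (p. 38).
* [Matsumura1987] H. Matsumura, *Commutative Ring Theory*, Thm 5.6 ff.
-/

noncomputable section

open MvPolynomial
open Literature.NumberTheory.Transcendental.Nesterenko

namespace Literature.NumberTheory.Transcendental

namespace PhilipponMain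

variable {m : ℕ}

/-- In a GCD domain the colon ideal of a principal ideal by an element is principal: if
`E = g E'`, `x = g x'` with `gcd(E', x')` a unit and `g ≠ 0`, then `((E) : x) = (E')`. [folklore] -/
theorem colon_span_singleton_eq {R : Type*} [CommRing R] [IsDomain R] [DecompositionMonoid R]
    {E x g E' x' : R}
    (hE : E = g * E') (hx : x = g * x') (hg : g ≠ 0) (hrel : IsRelPrime E' x') :
    (Ideal.span {E} : Submodule R R).colon {x} = Ideal.span {E'} := by
  ext r
  rw [Submodule.mem_colon_singleton, smul_eq_mul, Ideal.mem_span_singleton, Ideal.mem_span_singleton]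
  constructor
  · intro h
    -- `g E' ∣ r g x'` gives `E' ∣ r x'`, hence `E' ∣ r`
    rw [hE, hx] at h
    have h1 : E' ∣ r * x' := by
      have h2 : g * E' ∣ g * (r * x') := by
        have : r * (g * x') = g * (r * x') := by ring
        rwa [this] at h
      exact (mul_dvd_mul_iff_left hg).mp h2
    exact hrel.dvd_of_dvd_mul_right h1
  · intro h
    rw [hE, hx]
    obtain ⟨c, rfl⟩ := h
    exact ⟨c * x', by ring⟩

/-- **Principal ideals of `ℚ[x₀, …, x_m]` are unmixed of rank `m`** (projective dimension `m − 1`):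
for `E ≠ 0` not a unit, every associated prime `𝔭` of `(E)` is `(p)` for a prime factor `p` of `E`,
and `dim ℚ[x̲] ⧸ (p) = m`. This is the standing assumption of LNM 1752 Ch. 3 Prop. 4.8 for
"a principal ideal `I = (P)`". [cite: NesterenkoPhilippon2001, Ch. 3 Prop. 4.8 (p. 40)] -/
theorem isUnmixedOfRank_span_singleton {E : Rx m} (hE0 : E ≠ 0) (hEu : ¬ IsUnit E) :
    IsUnmixedOfRank (Ideal.span {E}) m := by
  classical
  letI : GCDMonoid (Rx m) := UniqueFactorizationMonoid.toGCDMonoid (Rx m)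
  refine ⟨?_, fun 𝔭 h𝔭 => ?_⟩
  · rwa [Ne, Ideal.span_singleton_eq_top]
  · obtain ⟨hprime, x, hx⟩ := Submodule.isAssociatedPrime_iff.mp h𝔭
    -- extract the gcd of `E` and `x`
    obtain ⟨E', x', hE, hxx, hunit⟩ := extract_gcd E x
    have hg0 : gcd E x ≠ 0 := fun h => hE0 (by rw [hE, h, zero_mul])
    have hrel : IsRelPrime E' x' := (gcd_isUnit_iff_isRelPrime.mp hunit)
    have hcolon : (Ideal.span {E} : Submodule (Rx m) (Rx m)).colon {x} = Ideal.span {E'} :=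
      colon_span_singleton_eq hE hxx hg0 hrel
    have h𝔭eq : 𝔭 = Ideal.span {E'} := by rw [hx]; exact hcolon
    -- `E'` is a prime element
    have hE'0 : E' ≠ 0 := fun h => hE0 (by rw [hE, h, mul_zero])
    have hE'prime : Prime E' := by
      have h := hprime
      rw [h𝔭eq, Ideal.span_singleton_prime hE'0] at h
      exact h
    rw [h𝔭eq, Literature.RingTheory.KrullDimension.ringKrullDim_quotient_span_of_prime_mvPolynomial
      hE'prime]
    simp

end PhilipponMain

end Literature.NumberTheory.Transcendental

end
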